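import Literature.NumberTheory.EllipticCurves.PAdicLFunctionTameProofs
import HarnessLib

/-!
# Birch's lemma at the level of the Mazur–Swinnerton-Dyer measures: a symbol-level twisting relation
# `[x]⁺_g = c · Σ_b χ(b) [x + b/m]⁺_f` makes `μ_{g, χ(p)α}` the `χ`-weighted tame measure of `f` (PROOFS ONLY)

Cell bsd-2adic, seat conv-1 (planner RULING RC-159, road P4 — the ALGEBRAIC step P4b; the analytic step P4a, the symbol-level
Birch lemma for the newform of a quadratic twist, is NOT done here and enters as the hypothesis `hB`). Mazur–Tate–Teitelbaum
(Invent. Math. 84 (1986), §I.8–I.10) and Matsuno (J. Number Theory 84 (2000), §2, p. 84: "`G_{p,m}(E, χ, T)` … is the `p`-adic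
`L`-function of the twist") pass from the twisted modular symbol to the twisted measure by the Chinese remainder theorem. In the
tree's vocabulary: let `f`, `g` be weight-`2` cusp forms, `χ` a `ℚ`-valued multiplicative character mod `m`, `(m, p) = 1`,
`χ(p)² = 1`, `c ∈ ℚ`, and suppose the symbol relation `hB : ∀ x, [x]⁺_g = c · Σ_{b mod m} χ(b) [x + b/m]⁺_f`. Then

* `tameFraction_mul_eq` — the tame fraction of the class `(a·m mod pⁿ, b·pⁿ mod m)` IS `a/pⁿ + b/m` (CRT, on the nose);
* `sum_mul_ratPlusSymbol_tameFraction_eq`, `…_prime_mul_tameFraction_eq` — the `χ`-weighted sums of `[c/(pⁿm)]⁺_f` and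
  `[p·c/(pⁿm)]⁺_f` over `b` are `χ(pⁿ)`, resp. `χ(p)χ(pⁿ)`, times the Birch sums at `x = a/pⁿ`, resp. `p·a/pⁿ`;
* **`msdMeasure_twist_eq_sum_msdMeasureTame`** — `μ_{g, χ(p)α}(a + pⁿℤ_p) = c · Σ_{b mod m} χ(b) · μ_{f,α,m}((a·m + pⁿℤ_p) × {b})`
  for every `n`, `a` (`msdMeasure g (χ(p)α) n a` vs `msdMeasureTame f m α n (a·m) b`).

What remains for road P4 after this file: (P4a) the relation `hB` for `g = f_{E^{(d)}}`, `f = f_E`, `χ = χ_d`, `c ∈ ℚ^×`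
(q-expansion twisting, Gauss sum, period ratio), and (P4c) the passage to the transforms via `tendsto_riemannSum_translate`.

References: B. Mazur, J. Tate, J. Teitelbaum, Invent. Math. 84 (1986), §I.8–§I.10 [MazurTateTeitelbaum1986Invent]; K. Matsuno,
J. Number Theory 84 (2000), §2 (p. 84) [Matsuno2000].
-/

noncomputable section

open scoped MatrixGroups ModularForm

open CongruenceSubgroup Literature.NumberTheory.EllipticCurves.ModularForms

namespace Literature.NumberTheory.EllipticCurves

section Birch

variable {N N' : ℕ} [NeZero N] [NeZero N'] (f : CuspForm (Gamma0 N) 2) (g : CuspForm (Gamma0 N') 2)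
  {p : ℕ} [Fact p.Prime] {m : ℕ} [NeZero m]

omit [NeZero N] [NeZero N'] [NeZero m] in
/-- **CRT on the nose**: the tame fraction of the class `(a·m mod pⁿ, b·pⁿ mod m)` is `a/pⁿ + b/m` exactly (`(a m) m⁻¹ = a`,
`(b pⁿ)(pⁿ)⁻¹ = b`, representatives in `[0, ·)`). [cite: MazurTateTeitelbaum1986Invent, §I.10 (10.1) (pp. 12–13)] -/
theorem tameFraction_mul_eq [NeZero m] (hmp : m.Coprime p) (n : ℕ) (a : ZMod (p ^ n)) (b : ZMod m) :
    tameFraction p m n (a * (m : ZMod (p ^ n))) (b * (p : ZMod m) ^ n) = (a.val : ℚ) / (p : ℚ) ^ n + (b.val : ℚ) / m := by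
  have hp : p.Prime := Fact.out
  haveI : NeZero (p ^ n) := ⟨pow_ne_zero _ hp.ne_zero⟩
  have hum : IsUnit (m : ZMod (p ^ n)) := by
    rw [ZMod.isUnit_iff_coprime]; exact hmp.pow_right n
  have hup : IsUnit ((p : ZMod m) ^ n) := by
    refine IsUnit.pow n ?_
    rw [ZMod.isUnit_iff_coprime]; exact hmp.symm
  have hpn : ((p : ℚ) ^ n) ≠ 0 := pow_ne_zero _ (by exact_mod_cast hp.ne_zero)
  have hm : (m : ℚ) ≠ 0 := by exact_mod_cast NeZero.ne m
  unfold tameFraction tameRep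
  rw [mul_assoc, ZMod.mul_inv_of_unit _ hum, mul_one, mul_assoc, ZMod.mul_inv_of_unit _ hup, mul_one]
  push_cast
  field_simp

/-- Reindexing a sum over `ℤ/m` by multiplication with a unit; private helper. [folklore] -/
private theorem sum_mul_unit_eq {R : Type*} [AddCommMonoid R] (u : (ZMod m)ˣ) (G : ZMod m → R) :
    ∑ b : ZMod m, G (b * (u : ZMod m)) = ∑ b : ZMod m, G b :=
  Fintype.sum_bijective (· * (u : ZMod m)) (Units.mulRight_bijective u) _ _ fun _ ↦ rfl

omit [NeZero N] [NeZero N'] in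
/-- **The `χ`-weighted sum of `[c/(pⁿm)]⁺_f` over `b mod m` is `χ(pⁿ)` times the Birch sum at `x = a/pⁿ`**:
`Σ_b χ(b)[tameFraction(n, a m, b)]⁺_f = χ(pⁿ) Σ_b χ(b)[a/pⁿ + b/m]⁺_f` (reindex `b ↦ b pⁿ`, `tameFraction_mul_eq`).
[cite: MazurTateTeitelbaum1986Invent, §I.8–I.10 (pp. 10–13)] -/
theorem sum_mul_ratPlusSymbol_tameFraction_eq (hmp : m.Coprime p) (χ : MulChar (ZMod m) ℚ) (n : ℕ)
    (a : ZMod (p ^ n)) :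
    ∑ b : ZMod m, χ b * ratPlusSymbol f (tameFraction p m n (a * (m : ZMod (p ^ n))) b) =
      χ ((p : ZMod m) ^ n) * ∑ b : ZMod m, χ b * ratPlusSymbol f ((a.val : ℚ) / (p : ℚ) ^ n + (b.val : ℚ) / m) := by
  have hcop : (p ^ n).Coprime m := (hmp.symm).pow_left n
  set u : (ZMod m)ˣ := ZMod.unitOfCoprime (p ^ n) hcop with hu
  have huval : (u : ZMod m) = (p : ZMod m) ^ n := by rw [hu, ZMod.coe_unitOfCoprime, Nat.cast_pow]
  rw [← sum_mul_unit_eq u, Finset.mul_sum]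
  refine Finset.sum_congr rfl fun b _ ↦ ?_
  rw [huval, tameFraction_mul_eq hmp n a b, map_mul]
  ring

omit [NeZero N'] in
/-- **The `χ`-weighted sum of `[p · c/(pⁿm)]⁺_f` over `b mod m`**: `χ(p) Σ_b χ(b)[p · tameFraction(n, a m, b)]⁺_f =
χ(pⁿ) Σ_b χ(b)[p a/pⁿ + b/m]⁺_f` (reindex `b ↦ b pⁿ`, then `b ↦ p b`, `[r + k]⁺ = [r]⁺` for the carry
`(p · b.val − (p b).val)/m ∈ ℤ`). [cite: MazurTateTeitelbaum1986Invent, §I.8–I.10 (pp. 10–13)] -/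
theorem sum_mul_ratPlusSymbol_prime_mul_tameFraction_eq (hmp : m.Coprime p) (χ : MulChar (ZMod m) ℚ) (n : ℕ)
    (a : ZMod (p ^ n)) :
    χ (p : ZMod m) * ∑ b : ZMod m, χ b * ratPlusSymbol f ((p : ℚ) * tameFraction p m n (a * (m : ZMod (p ^ n))) b) =
      χ ((p : ZMod m) ^ n) *
        ∑ b : ZMod m, χ b * ratPlusSymbol f ((p : ℚ) * ((a.val : ℚ) / (p : ℚ) ^ n) + (b.val : ℚ) / m) := by
  have hcop : (p ^ n).Coprime m := (hmp.symm).pow_left n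
  have hm0 : (m : ℚ) ≠ 0 := by exact_mod_cast NeZero.ne m
  set u : (ZMod m)ˣ := ZMod.unitOfCoprime (p ^ n) hcop with hu
  have huval : (u : ZMod m) = (p : ZMod m) ^ n := by rw [hu, ZMod.coe_unitOfCoprime, Nat.cast_pow]
  set w : (ZMod m)ˣ := ZMod.unitOfCoprime p hmp.symm with hw
  have hwval : (w : ZMod m) = (p : ZMod m) := by rw [hw, ZMod.coe_unitOfCoprime]
  -- left: reindex by `u = pⁿ` and evaluate the tame fraction
  have hL : ∑ b : ZMod m, χ b * ratPlusSymbol f ((p : ℚ) * tameFraction p m n (a * (m : ZMod (p ^ n))) b) =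
      χ ((p : ZMod m) ^ n) * ∑ b : ZMod m, χ b *
        ratPlusSymbol f ((p : ℚ) * ((a.val : ℚ) / (p : ℚ) ^ n) + (p : ℚ) * (b.val : ℚ) / m) := by
    rw [← sum_mul_unit_eq u, Finset.mul_sum]
    refine Finset.sum_congr rfl fun b _ ↦ ?_
    rw [huval, tameFraction_mul_eq hmp n a b, map_mul, mul_add, mul_div_assoc']
    ring
  -- right: reindex by `w = p` and remove the carry
  have hR : ∑ b : ZMod m, χ b * ratPlusSymbol f ((p : ℚ) * ((a.val : ℚ) / (p : ℚ) ^ n) + (b.val : ℚ) / m) =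
      χ (p : ZMod m) * ∑ b : ZMod m, χ b *
        ratPlusSymbol f ((p : ℚ) * ((a.val : ℚ) / (p : ℚ) ^ n) + (p : ℚ) * (b.val : ℚ) / m) := by
    rw [← sum_mul_unit_eq w, Finset.mul_sum]
    refine Finset.sum_congr rfl fun b _ ↦ ?_
    rw [hwval, map_mul]
    -- the carry: `(b p).val = p b.val - m k`
    have hk : ((m : ℤ) : ℤ) ∣ (p : ℤ) * b.val - ((b * (p : ZMod m)).val : ℤ) := by
      rw [← ZMod.intCast_zmod_eq_zero_iff_dvd]
      push_cast
      rw [ZMod.natCast_zmod_val, ZMod.natCast_zmod_val]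
      ring
    obtain ⟨k, hk⟩ := hk
    have e : (p : ℚ) * ((a.val : ℚ) / (p : ℚ) ^ n) + ((b * (p : ZMod m)).val : ℚ) / m =
        (p : ℚ) * ((a.val : ℚ) / (p : ℚ) ^ n) + (p : ℚ) * (b.val : ℚ) / m + ((-k : ℤ) : ℚ) := by
      have hk' : (((b * (p : ZMod m)).val : ℕ) : ℚ) = (p : ℚ) * b.val - (m : ℚ) * k := by
        have := congrArg (Int.cast : ℤ → ℚ) hk
        push_cast at this
        linarith
      rw [hk']
      push_cast
      field_simp
      ring
    rw [e, ratPlusSymbol_add_intCast_eq]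
    ring
  rw [hL, hR]
  ring

omit [NeZero N'] in
/-- **Birch's lemma at the level of the measures (the algebraic step).** Let `χ` be a `ℚ`-valued multiplicative character mod
`m`, `(m, p) = 1`, with `χ(p)² = 1`, `c ∈ ℚ`, and assume the symbol-level twisting relation
`hB : ∀ x, [x]⁺_g = c · Σ_{b mod m} χ(b) [x + b/m]⁺_f`. Then for every `n` and `a mod pⁿ`:
`μ_{g, χ(p)α}(a + pⁿℤ_p) = c · Σ_{b mod m} χ(b) · μ_{f,α,m}((a·m + pⁿℤ_p) × {b})`, i.e.
`msdMeasure g (χ(p)·α) n a = c · Σ_b χ(b) · msdMeasureTame f m α n (a·m) b` (`χ(pⁿ)·χ(p)^{∓1}` against `(χ(p)α)^{−n}`,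
`χ(p)² = 1`). [cite: MazurTateTeitelbaum1986Invent, §I.8–I.10 (pp. 10–13)] [cite: Matsuno2000, §2 (p. 84)] -/
theorem msdMeasure_twist_eq_sum_msdMeasureTame (hmp : m.Coprime p) (χ : MulChar (ZMod m) ℚ)
    (hχp : χ (p : ZMod m) ^ 2 = 1) {c : ℚ}
    (hB : ∀ x : ℚ, ratPlusSymbol g x = c * ∑ b : ZMod m, χ b * ratPlusSymbol f (x + (b.val : ℚ) / m))
    (α : ℚ_[p]) : ∀ (n : ℕ) (a : ZMod (p ^ n)),
    msdMeasure g (((χ (p : ZMod m) : ℚ) : ℚ_[p]) * α) n a =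
      (c : ℚ_[p]) * ∑ b : ZMod m, ((χ b : ℚ) : ℚ_[p]) * msdMeasureTame f m α n (a * (m : ZMod (p ^ n))) b := by
  have hp : p.Prime := Fact.out
  -- `χ(p)⁻¹ = χ(p)` and `χ(pⁿ) = χ(p)ⁿ`
  have hχp1 : χ (p : ZMod m) ≠ 0 := by
    intro h; rw [h] at hχp; norm_num at hχp
  have hinv : (((χ (p : ZMod m) : ℚ) : ℚ_[p]))⁻¹ = ((χ (p : ZMod m) : ℚ) : ℚ_[p]) := by
    have h2 : ((χ (p : ZMod m) : ℚ) : ℚ_[p]) * ((χ (p : ZMod m) : ℚ) : ℚ_[p]) = 1 := by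
      rw [← Rat.cast_mul, ← pow_two, hχp, Rat.cast_one]
    exact inv_eq_of_mul_eq_one_right h2
  have hpow : ∀ n : ℕ, χ ((p : ZMod m) ^ n) = χ (p : ZMod m) ^ n := fun n ↦ map_pow χ _ n
  -- the two Birch sums, cast to `ℚ_p`
  have key1 : ∀ (n : ℕ) (a : ZMod (p ^ n)),
      (c : ℚ_[p]) * ∑ b : ZMod m, ((χ b : ℚ) : ℚ_[p]) *
        (ratPlusSymbol f (tameFraction p m n (a * (m : ZMod (p ^ n))) b) : ℚ_[p]) =
        ((χ (p : ZMod m) : ℚ) : ℚ_[p]) ^ n * (ratPlusSymbol g ((a.val : ℚ) / (p : ℚ) ^ n) : ℚ_[p]) := by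
    intro n a
    have h := sum_mul_ratPlusSymbol_tameFraction_eq f hmp χ n a
    rw [hpow] at h
    have h' := congrArg (fun q : ℚ ↦ ((c * q : ℚ) : ℚ_[p])) h
    rw [hB ((a.val : ℚ) / (p : ℚ) ^ n)]
    push_cast at h' ⊢
    rw [h']
    ring
  have key2 : ∀ (n : ℕ) (a : ZMod (p ^ n)),
      (c : ℚ_[p]) * ∑ b : ZMod m, ((χ b : ℚ) : ℚ_[p]) *
        (ratPlusSymbol f ((p : ℚ) * tameFraction p m n (a * (m : ZMod (p ^ n))) b) : ℚ_[p]) =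
        ((χ (p : ZMod m) : ℚ) : ℚ_[p]) ^ (n + 1) *
          (ratPlusSymbol g ((p : ℚ) * ((a.val : ℚ) / (p : ℚ) ^ n)) : ℚ_[p]) := by
    intro n a
    have h := sum_mul_ratPlusSymbol_prime_mul_tameFraction_eq f hmp χ n a
    rw [hpow] at h
    -- multiply by `χ(p)` and use `χ(p)² = 1`
    have h1 : ∑ b : ZMod m, χ b * ratPlusSymbol f ((p : ℚ) * tameFraction p m n (a * (m : ZMod (p ^ n))) b) =
        χ (p : ZMod m) ^ (n + 1) *
          ∑ b : ZMod m, χ b * ratPlusSymbol f ((p : ℚ) * ((a.val : ℚ) / (p : ℚ) ^ n) + (b.val : ℚ) / m) := by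
      have := congrArg (fun q ↦ χ (p : ZMod m) * q) h
      rw [← mul_assoc, ← pow_two, hχp, one_mul] at this
      rw [this]
      ring
    have h' := congrArg (fun q : ℚ ↦ ((c * q : ℚ) : ℚ_[p])) h1
    rw [hB ((p : ℚ) * ((a.val : ℚ) / (p : ℚ) ^ n))]
    push_cast at h' ⊢
    rw [h']
    ring
  intro n a
  -- expand the right-hand side
  have hRHS : (c : ℚ_[p]) * ∑ b : ZMod m, ((χ b : ℚ) : ℚ_[p]) * msdMeasureTame f m α n (a * (m : ZMod (p ^ n))) b =
      α⁻¹ ^ n * ((c : ℚ_[p]) * ∑ b : ZMod m, ((χ b : ℚ) : ℚ_[p]) *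
        (ratPlusSymbol f (tameFraction p m n (a * (m : ZMod (p ^ n))) b) : ℚ_[p])) -
      α⁻¹ ^ (n + 1) * ((c : ℚ_[p]) * ∑ b : ZMod m, ((χ b : ℚ) : ℚ_[p]) *
        (ratPlusSymbol f ((p : ℚ) * tameFraction p m n (a * (m : ZMod (p ^ n))) b) : ℚ_[p])) := by
    simp only [msdMeasureTame, Finset.mul_sum, ← Finset.sum_sub_distrib]
    refine Finset.sum_congr rfl fun b _ ↦ ?_
    ring
  rw [hRHS, key1, key2]
  cases n with
  | zero =>
    have ha : a.val = 0 := by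
      have h1 : a.val < p ^ 0 := ZMod.val_lt a
      have h2 : p ^ 0 = 1 := rfl
      omega
    simp only [msdMeasure, ha, Nat.cast_zero, zero_div, mul_zero, pow_zero, one_mul, zero_add, pow_one, mul_inv, hinv]
    ring
  | succ n =>
    have hp0 : (p : ℚ) ≠ 0 := by exact_mod_cast hp.ne_zero
    have hx : (p : ℚ) * ((a.val : ℚ) / (p : ℚ) ^ (n + 1)) = (a.val : ℚ) / (p : ℚ) ^ n := by
      rw [pow_succ (p : ℚ) n]; field_simp
    simp only [msdMeasure, hx, mul_inv, inv_pow, hinv]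
    ring

end Birch

end Literature.NumberTheory.EllipticCurves

end
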